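import Mathlib.Data.Real.Basic
import Mathlib.Tactic.Linarith
import Mathlib.Tactic.Positivity
import HarnessLib

/-!
# Shell bounds on the recast circle `σ² + κ² = 2κ` (elementary real algebra for manifold-aware box covers)

Venture GRIDFUSION, cell `gridfusion`, `plan/PARTITION.md` §0 row `Lyapunov/`; seat gridfusion-lyap-2 (g5), lever L1 of
`HOME/lean/lyap-2/g5/LEVER-NOTE.md`; namespace `Summit.Ventures.GridStability.Lyapunov.RecastShell`. Everything is PROVED
(no definition, no named fact, standard axioms); pure algebra — nothing here mentions a grid, a machine or a certificate.

In the polynomial recast of an angle `u` (`σ = sin u`, `κ = 1 − cos u`) the recast constraint `h = σ² + κ² − 2κ = 0` says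
that `(σ, 1 − κ)` lies on the unit circle, so on the branch `κ ≤ 1` (`|u| ≤ π/2`, the only branch inside a small gauge
ball) `κ = 1 − √(1 − σ²)` is PINNED by `σ²`. The box covers of the cell's «BALL» riders (`Bench/*Ball*.lean`, tool
`Lyapunov/PolyRecastBox.lean`) bound a certificate polynomial `V` on boxes in `(σ, κ, ω)`; these four lemmas let such a
cover use the circle instead of treating `κ` as free in `[0, s²/2]`, with RATIONAL literals checked by `norm_num` at the
call site (no square roots in the kernel):

* `kappa_nonneg` — `0 ≤ κ`;
* `sq_le_of_kappa_le` — `κ ≤ m ≤ 1 ⇒ σ² ≤ 2m − m²` (the cutoff: with `m = s²/2`, `σ² ≤ s² − s⁴/4`);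
* `kappa_le_of_sq_le` — `σ² ≤ t` and a rational `khi` with `(1 − khi)² ≤ 1 − t` ⇒ `κ ≤ khi` (i.e. `khi ≥ 1 − √(1 − t)`);
* `lt_kappa_of_lt_sq` — `t < σ²` and a rational `klo ≤ 1` with `1 − t ≤ (1 − klo)²` ⇒ `klo < κ` (i.e. `klo ≤ 1 − √(1 − t)`).

Source for the mathematics: folklore (monotonicity of `x ↦ 1 − √(1 − x)` on `[0, 1]`, written without roots).
-/

namespace Summit.Ventures.GridStability.Lyapunov.RecastShell

/-- On the recast circle `σ² + κ² = 2κ`, `κ ≥ 0`. [folklore] -/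
theorem kappa_nonneg {σ κ : ℝ} (h : σ ^ 2 + κ ^ 2 = 2 * κ) : 0 ≤ κ := by
  nlinarith [sq_nonneg σ, sq_nonneg κ]

/-- **Cutoff.** On the recast circle, `κ ≤ m ≤ 1` forces `σ² = 2κ − κ² ≤ 2m − m²`
(`2m − m² − σ² = (m − κ)(2 − m − κ) ≥ 0`). With `m = s²/2`: `σ² ≤ s² − s⁴/4`. [folklore] -/
theorem sq_le_of_kappa_le {σ κ m : ℝ} (h : σ ^ 2 + κ ^ 2 = 2 * κ) (hm : κ ≤ m) (hm1 : m ≤ 1) :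
    σ ^ 2 ≤ 2 * m - m ^ 2 := by
  nlinarith [mul_nonneg (sub_nonneg.2 hm) (show (0 : ℝ) ≤ 2 - m - κ by linarith)]

/-- **Upper shell bound.** On the recast circle with `κ ≤ 1`: if `σ² ≤ t` and `khi` satisfies
`(1 − khi)² ≤ 1 − t` (a rational stand-in for `khi ≥ 1 − √(1 − t)`; no sign hypothesis on `khi` is needed, since
`khi < κ ≤ 1` is the case refuted), then `κ ≤ khi` (`(1 − κ)² = 1 − σ² ≥ 1 − t ≥ (1 − khi)²` and `1 − κ ≥ 0`). [folklore] -/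
theorem kappa_le_of_sq_le {σ κ t khi : ℝ} (h : σ ^ 2 + κ ^ 2 = 2 * κ) (hκ : κ ≤ 1) (hσ : σ ^ 2 ≤ t)
    (hk : (1 - khi) ^ 2 ≤ 1 - t) : κ ≤ khi := by
  by_contra hcon
  have hlt : khi < κ := lt_of_not_ge hcon
  nlinarith [mul_pos (sub_pos.2 hlt) (show (0 : ℝ) < (1 - κ) + (1 - khi) by linarith)]

/-- **Lower shell bound.** On the recast circle with `κ ≤ 1`: if `t < σ²` and `klo ≤ 1` satisfies
`1 − t ≤ (1 − klo)²` (a rational stand-in for `klo ≤ 1 − √(1 − t)`), then `klo < κ`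
(`(1 − κ)² = 1 − σ² < 1 − t ≤ (1 − klo)²` and `1 − κ ≥ 0`). [folklore] -/
theorem lt_kappa_of_lt_sq {σ κ t klo : ℝ} (h : σ ^ 2 + κ ^ 2 = 2 * κ) (hκ : κ ≤ 1) (hσ : t < σ ^ 2)
    (hk : 1 - t ≤ (1 - klo) ^ 2) (hk1 : klo ≤ 1) : klo < κ := by
  by_contra hcon
  have hle : κ ≤ klo := le_of_not_gt hcon
  nlinarith [mul_nonneg (sub_nonneg.2 hle) (show (0 : ℝ) ≤ (1 - κ) + (1 - klo) by linarith)]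

end Summit.Ventures.GridStability.Lyapunov.RecastShell
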